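import Mathlib
import HarnessLib
import Literature.Computability.Complexity.CNF
import Literature.Computability.Complexity.PNPWave0
import Summits.PneNP.PneNP.Theses.OverlapGapAlgebra
import Summits.PneNP.PneNP.Theorems.OverlapGapAlgebraSearchHardWindowCore
import Summits.PneNP.PneNP.Theorems.OverlapGapAlgebraSearchHardWindowDensityMonotone
import Summits.PneNP.PneNP.Theorems.OverlapGapAlgebraSearchHardWindowWindowGlue

/-!
# Line `IdeaSketch_r2_k6` — skeleton v3.1 (crux stmt-PneNP-2460 `SearchHardWindow`, lead c4)

History. v1/v2 (lead a1, 2026-08-16): the exact self-couplings of the literal-array model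
(variable quotient `v ↦ v / q`, first-literal truncation) give DETERMINISTIC monotonicity of the
crux's hardness conjunct `H(k, α)` ("every polynomial-time word function solves `F_k(n, ⌊α n⌋)` with
probability `→ 0`"): `H(k + j, α) → H(k, q·α)`. All bricks and the monotonicity LANDED
(`stub_requotPolyTime` p127921, `stub_stretchPolyTime` p127970, `stub_retruncPolyTime` p128324,
`…ExactCouplings` p128450, `…DensityMonotone` p128597); v2's single open stub was the flow SOURCE
`stub_hardAtFlow : ∃ k j q α, 1024 ≤ k ∧ 0 < q ∧ q·α < ρ_k ∧ H(k + j, α)`.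

v3 (this file). The flow only transports hardness towards larger density / smaller width, so the
weakest member of the admissible family is `H` itself at a density of uniformly positive
satisfiability; v3 therefore registers the kernel in its cleanest and weakest form, AT THE WINDOW:

* `stub_windowHard` (KERNEL, the only `sorry`): `∃ k ≥ 1024, H(k, α_k)`, `α_k = 5·2^k·log k/k` —
  verbatim the `hhard` binder of the tree theorem `searchHardWindow_of_hard_at_window` and the body
  of the conditional bridge `RandomKSatWindowHard` proposed in
  `Cruxes/SearchHardWindow/STRATEGY-CENSUS.md` §0.2(b).

Composition `SearchHardWindow_of`: `stub_windowHard` ⟹ crux, by the ROUTE-FILE-FREE glue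
`shwW_searchHardWindow_of_windowHard` (LANDED p137585, `Theorems/…SearchHardWindowWindowGlue.lean`:
positivity at the window = Achlioptas–Peres `achlioptasPeres2004_uniformlyPos` with `α_k < ρ_k`
re-derived inline; the same module carries `shwW_pneNP_of_windowHard` and the route-free body of
item 2464, so the route file's `closes` can consume the stub's statement as a conditional-bridge
hypothesis without an import cycle — STRATEGY-CENSUS pass 3 §0.2(b)/§0.3). The v2 form remains admissible: `searchHardWindow_of_flowWitness` (any flow source
suffices, `shwQ_searchHardWindow_of_hardAt_flow`), and `flowWitness_of_windowHard` (v3's stub is the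
`j = 0, q = 1` source, since `α_k < ρ_k`).

HONEST STATUS OF THE STUB: it is crux-sized — `stub_statement_cruxSized` below proves `PneNP` from
the stub's statement alone (tree: `searchHardWindow_implies_pneNP`); no line on this crux has a
weaker kernel (`Census3.simKernel_iff_hard`, STRATEGY-CENSUS pass 3 §1). It is handed back to the
planners as `promote-stub` (route end-state (b): conditional bridge on exactly this statement).

Lead prover-line-stmt-PneNP-2460-c4-0, 2026-08-17.
-/

namespace Summit.PneNP.PneNP.Cruxes.SearchHardWindow.ExactCouplings

set_option linter.dupNamespace false

open Filter Literature.Computability.Complexity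
open Summit.PneNP.PneNP.Theses.OverlapGapAlgebra
open Summit.PneNP.PneNP.Theorems

noncomputable section

/-- The Achlioptas–Peres radius `ρ_k = (2^k log 2 - (k+1) log 2 / 2 - 1) - 2·δ_k` (verbatim the
density bound of `searchHardWindow_of_hard_below_rho`). -/
def rho (k : ℕ) : ℝ :=
  (2 ^ k * Real.log 2 - ((k : ℝ) + 1) * Real.log 2 / 2 - 1) -
    2 * (15 * (k : ℝ) ^ 2 / 2 ^ k + (((k : ℝ) + 3) / 2 ^ k + 32 * (k : ℝ) ^ 2 * (50 / 81) ^ k +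
      32 * (k : ℝ) * (5 / 9) ^ k))

/-- `HardAt K α`: the crux's hardness conjunct at clause width `K` and density `α` — every
polynomial-time word function solves `F_K(n, ⌊α n⌋)` with probability `→ 0` (verbatim the second
conjunct of `SearchHardWindow`). -/
def HardAt (K : ℕ) (α : ℝ) : Prop :=
  ∀ f : List Bool → List Bool, IsPolyTime f → ∀ ε : ℝ, 0 < ε →
    ∀ᶠ n : ℕ in atTop, ∀ m : ℕ, m = ⌊α * n⌋₊ →
      ((Finset.univ.filter fun Φ : Fin m → Fin K → Fin n × Bool => ∀ i, ∃ j,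
        (f (encodingCNF.encode (List.ofFn fun a => List.ofFn fun b =>
          (((Φ a b).1 : ℕ), (Φ a b).2)))).getD (Φ i j).1 false = (Φ i j).2).card : ℝ) /
        Fintype.card (Fin m → Fin K → Fin n × Bool) ≤ ε

/-! ## The stub -/

/-- STUB (KERNEL, lead): **hardness of random `k`-SAT search for all of `P` at the window density.**
For some `k ≥ 1024`, every polynomial-time word function `f` (input: the `encodingCNF`-code of the
clause list of `Φ`; output word read as the table `v ↦ y.getD v false`) solves the uniformly random
literal array `Φ : Fin ⌊α_k n⌋₊ → Fin k → Fin n × Bool`, `α_k = 5·2^k·log k/k`, with probability `→ 0`.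
This is the bare hardness conjunct `H(k, α_k)` of the crux (Achlioptas–Peres 2004 §11 Question 2
inside the Bresler–Huang OGP window); it implies `PneNP` (`stub_statement_cruxSized`). -/
theorem stub_windowHard :
    ∃ k : ℕ, 1024 ≤ k ∧ ∀ f : List Bool → List Bool, IsPolyTime f → ∀ ε : ℝ, 0 < ε →
      ∀ᶠ n : ℕ in Filter.atTop, ∀ m : ℕ, m = ⌊5 * 2 ^ k * Real.log k / k * n⌋₊ →
        ((Finset.univ.filter fun Φ : Fin m → Fin k → Fin n × Bool => ∀ i, ∃ j,
          (f (encodingCNF.encode (List.ofFn fun a => List.ofFn fun b =>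
            (((Φ a b).1 : ℕ), (Φ a b).2)))).getD (Φ i j).1 false = (Φ i j).2).card : ℝ) /
          Fintype.card (Fin m → Fin k → Fin n × Bool) ≤ ε := by
  sorry

/-! ## Composition -/

/-- **Composition (v3.1).** The window kernel gives the crux, through the route-file-free glue
`shwW_searchHardWindow_of_windowHard` (p137585): positivity of satisfiability at `(k, α_k)`,
`k ≥ 1024`, is Achlioptas–Peres (`achlioptasPeres2004_uniformlyPos`, `α_k < ρ_k`); the term
elaborates against the route decl by unfolding `SearchHardWindow`. -/
theorem SearchHardWindow_of : Summit.PneNP.PneNP.Theses.OverlapGapAlgebra.SearchHardWindow :=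
  shwW_searchHardWindow_of_windowHard stub_windowHard

/-! ## Status certificates (no `sorry` below this line feeds `SearchHardWindow_of`) -/

/-- **The stub is crux-sized.** Its statement alone proves the summit `PneNP` (route-free:
`shwW_pneNP_of_windowHard`, p137585 — Achlioptas–Peres positivity, the assembly
`overlapGapAlgebra_assembly_proof` and the plumbing `overlapGap_evalRelationInP`): promoting it to an
item / conditional bridge loses nothing and hides nothing. -/
theorem stub_statement_cruxSized
    (h : ∃ k : ℕ, 1024 ≤ k ∧ ∀ f : List Bool → List Bool, IsPolyTime f → ∀ ε : ℝ, 0 < ε →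
      ∀ᶠ n : ℕ in Filter.atTop, ∀ m : ℕ, m = ⌊5 * 2 ^ k * Real.log k / k * n⌋₊ →
        ((Finset.univ.filter fun Φ : Fin m → Fin k → Fin n × Bool => ∀ i, ∃ j,
          (f (encodingCNF.encode (List.ofFn fun a => List.ofFn fun b =>
            (((Φ a b).1 : ℕ), (Φ a b).2)))).getD (Φ i j).1 false = (Φ i j).2).card : ℝ) /
          Fintype.card (Fin m → Fin k → Fin n × Bool) ≤ ε) :
    _root_.PneNP :=
  shwW_pneNP_of_windowHard h

/-- **v2's admissible family still suffices.** Any flow source — hardness of `F_{k+j}(n, ⌊α n⌋)` for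
all of `P` with `k ≥ 1024`, `q ≥ 1`, `q·α < ρ_k` — gives the crux (landed composition
`shwQ_searchHardWindow_of_hardAt_flow`, through the exact couplings and the three transcoder
bricks). -/
theorem searchHardWindow_of_flowWitness
    (h : ∃ (k j q : ℕ) (α : ℝ), 1024 ≤ k ∧ 0 < q ∧ (q : ℝ) * α < rho k ∧ HardAt (k + j) α) :
    Summit.PneNP.PneNP.Theses.OverlapGapAlgebra.SearchHardWindow := by
  obtain ⟨k, j, q, α, hk, hq, hlt, hH⟩ := h
  exact shwQ_searchHardWindow_of_hardAt_flow (j := j) hk hq hlt hH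

/-- **v3's stub is the weakest flow source.** `H(k, α_k)` with `k ≥ 1024` is the `j = 0`, `q = 1`
member of v2's family, because `α_k < ρ_k` (`positiveSatProbability_window_density_lt_rho`). -/
theorem flowWitness_of_windowHard
    (h : ∃ k : ℕ, 1024 ≤ k ∧ HardAt k (5 * 2 ^ k * Real.log k / k)) :
    ∃ (k j q : ℕ) (α : ℝ), 1024 ≤ k ∧ 0 < q ∧ (q : ℝ) * α < rho k ∧ HardAt (k + j) α := by
  obtain ⟨k, hk, hH⟩ := h
  refine ⟨k, 0, 1, 5 * 2 ^ k * Real.log k / k, hk, one_pos, ?_, by simpa using hH⟩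
  rw [Nat.cast_one, one_mul]
  exact positiveSatProbability_window_density_lt_rho hk

/-- The stub, read through `HardAt` (definitional bookkeeping for the two certificates above). -/
theorem stub_windowHard_iff :
    (∃ k : ℕ, 1024 ≤ k ∧ HardAt k (5 * 2 ^ k * Real.log k / k)) ↔
      ∃ k : ℕ, 1024 ≤ k ∧ ∀ f : List Bool → List Bool, IsPolyTime f → ∀ ε : ℝ, 0 < ε →
        ∀ᶠ n : ℕ in Filter.atTop, ∀ m : ℕ, m = ⌊5 * 2 ^ k * Real.log k / k * n⌋₊ →
          ((Finset.univ.filter fun Φ : Fin m → Fin k → Fin n × Bool => ∀ i, ∃ j,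
            (f (encodingCNF.encode (List.ofFn fun a => List.ofFn fun b =>
              (((Φ a b).1 : ℕ), (Φ a b).2)))).getD (Φ i j).1 false = (Φ i j).2).card : ℝ) /
            Fintype.card (Fin m → Fin k → Fin n × Bool) ≤ ε :=
  Iff.rfl

end

end Summit.PneNP.PneNP.Cruxes.SearchHardWindow.ExactCouplings
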